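import Summits.RiemannHypothesis.RiemannHypothesis.Theorems.SemilocalNegCertThirtyOneKinked1812
import HarnessLib

/-!
# Semi-local threshold of the `{∞,2,…,31}` form, negative side: `a*({2,…,31}) ≤ 1855 / 1024 = 1.8115234375` — the wall `q = 37` from a KINKED (piecewise-cubic) witness with slope breaks at the prime-atom images (part 9/14: the kernel facts piece 110 … piece 123 of 163 (imports part 1 only))

Cell `rh-explicit` (HOME `run/shared/lean/pub/rh-explicit/`), seat cc-s2-9 gen2 (HUMAN RULING D-0074 (D5) WEIL data engine; LADDER-RH column WEIL, rung DATA → W-P(P2);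
pipeline = cc-s2-4 gen8/gen11's piecewise-witness layer `SemilocalPiecewise{Witness,Increment,IncrementSum,Cert}.lean` + their float finder, every number
re-derived by an independent second engine E2 before filing; gen0's rows: `SemilocalNegCert{ThirteenKinked1423,SeventeenKinked1478,NineteenKinked1573,TwentyThreeKinked1690,TwentyNineKinked1723}*`).
HONEST FRAMING: RH-FREE theorems about the tree's `weilSemilocalThreshold S` of a TRUNCATED Weil form (finitely many places); nothing here bears on the
truth of RH; the lower clause `(log q)/2 ≤ a*(S_q)` at all primes IS RH and is untouched; the SIGN of `δ*(37)` is not claimed.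

KINKED row for the wall `q = 37` (`S = {2,…,31}`): at `b = 1855 / 1024 = 1.8115234375 ≈ a*(S_37) + 0.0060` (DATA, two engines, cc-s2-6/cc-s2-3: `a*(S_37) = 1.8055313`)
the polynomial × indicator class is far from negative (tree row `233/128`, `SemilocalNegCertUptoThirtyOne`, `δ*(37) ≤ 0.0149`), whereas an odd piecewise cubic with slope breaks at the images
`|b − log n|` (rounded to `/1024`) of the atoms `n ∈ {2,3,5,7,11,13,17,19,23,29,31}` (the eleven PRIME atoms; images of 4, 8, 9, 16, 25, 27, 32 dropped — with all eighteen kinks λ_min = −8.91·10⁻³, with the primes + 4 + 9: −4.91·10⁻³; kit j253132) is negative by `1.961e-03·‖G‖²`.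
Instance: `S = {2, 3, 5, 7, 11, 13, 17, 19, 23, 29, 31}`, `N = 39` (atom table `atomsUptoThirtyOne` / `atomsEnclose_UptoThirtyOne` of `SemilocalNegCertUptoThirtyOne.lean`), 12 pieces of degree ≤ 3, 163 `t`-pieces;
TWO ENGINES on the witness before the kernel: cc-s2-4's float finder `λ_min = -1.9606e-03` and the seat's exact-in-`x` decimal engine E2 `R = -1.9625e-03` (no polar credit);
the exact kernel margin is the certificate's own rational arithmetic (farm report).  ⇒ **`a*({2,…,31}) ≤ 1855 / 1024`, `δ*(37) < 0.006065`** (was `0.0149`).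
No data is trusted: every bound is a `decide +kernel` fact.  Folklore throughout.
-/

set_option autoImplicit false
set_option linter.dupNamespace false  -- the mandated namespace repeats `RiemannHypothesis`
set_option Elab.async false  -- serialise the kernel facts: in parallel they exhaust the node's per-process heap (cc-s2-4 gen11, CC4-LEAN §16.10)

noncomputable section

open Complex Filter Set MeasureTheory Topology
open scoped Real

namespace Summit.RiemannHypothesis.RiemannHypothesis.Theorems.SemilocalPolyWitness

open MeasureTheory Set Finset Real
open Literature.NumberTheory.LFunctions
open Summit.RiemannHypothesis.RiemannHypothesis.Theorems.MotivicDoor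
open Summit.RiemannHypothesis.RiemannHypothesis.Theorems.MotivicDoor.SemilocalThreshold
open Summit.RiemannHypothesis.RiemannHypothesis.Theorems.MotivicDoor.SemilocalMarkov
open LQ

set_option maxHeartbeats 0 in
/-- kernel fact: piece `110` of `certThirtyOneKinked1812`. -/
theorem check_ThirtyOneKinked1812_piece110 : certThirtyOneKinked1812.checkPiecePW 110 = true := by
  decide +kernel

set_option maxHeartbeats 0 in
/-- kernel fact: piece `111` of `certThirtyOneKinked1812`. -/
theorem check_ThirtyOneKinked1812_piece111 : certThirtyOneKinked1812.checkPiecePW 111 = true := by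
  decide +kernel

set_option maxHeartbeats 0 in
/-- kernel fact: piece `112` of `certThirtyOneKinked1812`. -/
theorem check_ThirtyOneKinked1812_piece112 : certThirtyOneKinked1812.checkPiecePW 112 = true := by
  decide +kernel

set_option maxHeartbeats 0 in
/-- kernel fact: piece `113` of `certThirtyOneKinked1812`. -/
theorem check_ThirtyOneKinked1812_piece113 : certThirtyOneKinked1812.checkPiecePW 113 = true := by
  decide +kernel

set_option maxHeartbeats 0 in
/-- kernel fact: piece `114` of `certThirtyOneKinked1812`. -/
theorem check_ThirtyOneKinked1812_piece114 : certThirtyOneKinked1812.checkPiecePW 114 = true := by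
  decide +kernel

set_option maxHeartbeats 0 in
/-- kernel fact: piece `115` of `certThirtyOneKinked1812`. -/
theorem check_ThirtyOneKinked1812_piece115 : certThirtyOneKinked1812.checkPiecePW 115 = true := by
  decide +kernel

set_option maxHeartbeats 0 in
/-- kernel fact: piece `116` of `certThirtyOneKinked1812`. -/
theorem check_ThirtyOneKinked1812_piece116 : certThirtyOneKinked1812.checkPiecePW 116 = true := by
  decide +kernel

set_option maxHeartbeats 0 in
/-- kernel fact: piece `117` of `certThirtyOneKinked1812`. -/
theorem check_ThirtyOneKinked1812_piece117 : certThirtyOneKinked1812.checkPiecePW 117 = true := by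
  decide +kernel

set_option maxHeartbeats 0 in
/-- kernel fact: piece `118` of `certThirtyOneKinked1812`. -/
theorem check_ThirtyOneKinked1812_piece118 : certThirtyOneKinked1812.checkPiecePW 118 = true := by
  decide +kernel

set_option maxHeartbeats 0 in
/-- kernel fact: piece `119` of `certThirtyOneKinked1812`. -/
theorem check_ThirtyOneKinked1812_piece119 : certThirtyOneKinked1812.checkPiecePW 119 = true := by
  decide +kernel

set_option maxHeartbeats 0 in
/-- kernel fact: piece `120` of `certThirtyOneKinked1812`. -/
theorem check_ThirtyOneKinked1812_piece120 : certThirtyOneKinked1812.checkPiecePW 120 = true := by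
  decide +kernel

set_option maxHeartbeats 0 in
/-- kernel fact: piece `121` of `certThirtyOneKinked1812`. -/
theorem check_ThirtyOneKinked1812_piece121 : certThirtyOneKinked1812.checkPiecePW 121 = true := by
  decide +kernel

set_option maxHeartbeats 0 in
/-- kernel fact: piece `122` of `certThirtyOneKinked1812`. -/
theorem check_ThirtyOneKinked1812_piece122 : certThirtyOneKinked1812.checkPiecePW 122 = true := by
  decide +kernel

set_option maxHeartbeats 0 in
/-- kernel fact: piece `123` of `certThirtyOneKinked1812`. -/
theorem check_ThirtyOneKinked1812_piece123 : certThirtyOneKinked1812.checkPiecePW 123 = true := by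
  decide +kernel

end Summit.RiemannHypothesis.RiemannHypothesis.Theorems.SemilocalPolyWitness

end
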